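import Summits.HodgeConjecture.HodgeConjecture.Theorems.R90S2ArchBlockPacketEndoscopyLetterDefs      -- ★ p865021 v2 `ArchBlockPacketEndoscopyLetter` (full packets; (E2) GLOBAL)
import Summits.HodgeConjecture.HodgeConjecture.Theorems.R90S2ArchBlockPacketEndoscopyLetterLocDefs   -- ★ p865292 v3 `ArchBlockPacketEndoscopyLetterLoc` (typ2; (E2) LOCAL via ★ CARD 11 `IsArchLocStablyNull`)
import Summits.HodgeConjecture.HodgeConjecture.Theorems.R90S2ArchHaarPiRightInvariant              -- ★ p865191 CARD 6♯ (K2E3-p25): `isMulRightInvariant_of_map_archPiEquivCM_eq_pi`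
import Summits.HodgeConjecture.HodgeConjecture.Theorems.R90S2ArchStablyNullOfLocal                 -- ★ p865170 CARD 11 (mine): `isArchStablyNull_archTensor_update_of_isArchLocStablyNull`
import HarnessLib

/-!
# R90-TF ∕ S2 «Ch. 12 archimedean block» — `R90S2ArchBlockPacketEndoscopyLetterOfLoc` (CARD 12): the BRIDGE «v3-Loc letter ⇒ v2 letter» —
# `ArchBlockPacketEndoscopyLetterLoc L μ S → ArchBlockPacketEndoscopyLetter L μ S` (clause (E2) LOCAL at one place ⇒ (E2) GLOBAL, in T2's frame)

Cell `pub/hodgecm-mathlib`, HCML Track R90-TF, section S2 (base `R90-C11`), crux h413 = `stmt-HodgeConjecture-24833`, route of record `HCCMUnconditional`; prover seat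
LH4-p05 (g11) (S2 desk K2E1b-plan (g9) RULING R-S2-D4 + DEAL 2026-09-05T03:44:26Z); lane `--kind proof --supports stmt-HodgeConjecture-24833 --as helper` (ONE theorem).
Conventions of ★ FILE 1: no socket, no instance, no notation, no `sorry`, default heartbeats.

## WHAT
`archBlockPacketEndoscopyLetter_of_loc (μ) (S) : ArchBlockPacketEndoscopyLetterLoc L μ S → ArchBlockPacketEndoscopyLetter L μ S`.  The two letters share T2's frame
VERBATIM (Haar `ν, νH`, families `mH mG tH t`, (W) `mG.IsQuotientOf (IsRegularElt ·) ν t`, (C) the ★ `archStableCentralizerEquiv` transport of `t`, ★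
`ArchCompatibleFamiliesH`, non-degeneracy, transfer existence, local Haar `νw` with `ν.map e = ⊗ νw`) and the conclusions (E1)(E3); they differ in (E2):
v3 (typ2, R-S2-D4) states it LOCALLY at the place `u` — ★ CARD 11 `IsArchLocStablyNull L u (νw u) ⇑(φ_u^{bpos} − φ_u^{bneg})` (print p. 218 L18–21 IS local) — for
RIGHT-INVARIANT `νw` and the Borel σ-algebras on the local centralizer quotients; v2 states it GLOBALLY (★ `S10.IsArchStablyNull L mG` of the one-place difference
tensor).  PROOF: introduce the v2 frame; the local Haar factors `νw w` of the right-invariant `ν` are right-invariant (★ CARD 6♯ `isMulRightInvariant_of_map_archPiEquivCM_eq_pi`);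
fix the local centralizer-quotient σ-algebras to `borel` (the v3 letter's `letI` chain, so that ★ CARD 11 reads clause (E2) in the letter's instances); take the packet data
`d` of the v3 letter; (E1)(E3) pass through byte-identically and (E2)-global at `u` is ★ CARD 11 §3 `isArchStablyNull_archTensor_update_of_isArchLocStablyNull` (★ CARD 3
`isArchStablyNull_of_place` ∘ ★ FILE 3c `isArchProductFamily_archLocWeilFamily`, i.e. T2's (W)(C) ⇒ per-stable-class product families of the local Weil families).
JUNCTION for D ED. 4 (typ2's `build_ed4.py`): `letter_R90_S2_blockPacketEndoscopy := fun L _ _ _ μ => archBlockPacketEndoscopyLetter_of_loc L μ _ (letter_R90_S2_blockPacketEndoscopyLoc L μ)`.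

HONEST LABEL: plumbing (an instance supply + ★ CARD 11 §3); pays NOTHING printed — it relocates the letter clause (E2) to print's LOCAL shape (Shelstad's local vanishing
stays letter ℓ4 inside v3); HC_CM is proved only modulo the 7 printed citations (2 remaining named inputs: hLiu418 = `stmt-HodgeConjecture-24832`, h413 =
`stmt-HodgeConjecture-24833`) until rung 0 closes.  Count-neutral.

References: [Rogawski1990] §13.8 Prop. 13.8.3 (proof) p. 218 L11–25, §4.3 (4.3.1) p. 43; [Shelstad1979] L. 5.3; [Arthur1988InvariantTraceFormulaII] §7.
-/

set_option autoImplicit false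
set_option linter.dupNamespace false  -- the route namespace `Summit.HodgeConjecture.HodgeConjecture.…` repeats a component by design (as ★ FILE 1)

noncomputable section

open NumberField NumberField.InfinitePlace MeasureTheory CompactlySupported
open scoped Matrix MatrixGroups InnerProductSpace

namespace Summit.HodgeConjecture.HodgeConjecture.R90.S2

open Literature.NumberTheory.Automorphic Literature.NumberTheory.Automorphic.UnitaryGroup
open Literature.NumberTheory.Rogawski1990
open Literature.NumberTheory.GaloisRepresentations (HeckeCharacter)
open Summit.HodgeConjecture.HodgeConjecture.R90.S10 (GInf HInf phi3 archDeltaPP IsArchEndoCharId IsArchStablyNull)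

section Bridge

variable (L : Type) [Field L] [NumberField L] [IsCMField L]

open scoped Classical in
/-- **CARD 12 — THE LOCAL-(E2) ENDOSCOPY LETTER IMPLIES THE GLOBAL-(E2) ONE**: `ArchBlockPacketEndoscopyLetterLoc L μ S → ArchBlockPacketEndoscopyLetter L μ S`.
In T2's frame the local Haar factors of the right-invariant `ν ≅ ⊗ νw` are right-invariant (★ CARD 6♯), so the v3 letter applies; its packet data `d` serve
verbatim, (E1)(E3) pass through, and (E2) «`φ_u^{bpos} − φ_u^{bneg}` is LOCALLY stably null at `u`» gives the global stable nullity of the one-place difference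
tensor `⊗ (update φ^{bpos} u (φ_u^{bpos} − φ_u^{bneg}))` by ★ CARD 11 (print p. 218 L18–21: the one-place difference has vanishing stable orbital integrals).
[cite: Rogawski1990, §13.8 p. 218 L18–21; §4.3 (4.3.1) p. 43] [cite: Shelstad1979, L. 5.3] [cite: Arthur1988InvariantTraceFormulaII, §7] -/
theorem archBlockPacketEndoscopyLetter_of_loc (μ : HeckeCharacter L)
    (S : ∀ w : {w : InfinitePlace L // w.IsComplex}, C_c(↥(archLocal L 3 (phi3 L) w), ℂ) → Prop) :
    ArchBlockPacketEndoscopyLetterLoc L μ S → ArchBlockPacketEndoscopyLetter L μ S := by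
  intro hLoc _ _ ν _ _ _ _ νH _ _ mH mG tH t hW hC hH hnd hex _ _ νw _ hν
  -- the local Haar factors of the right-invariant `ν` are right-invariant (★ CARD 6♯)
  haveI : ∀ w : {w : InfinitePlace L // w.IsComplex}, (νw w).IsMulRightInvariant := fun w =>
    isMulRightInvariant_of_map_archPiEquivCM_eq_pi L ν νw hν w
  -- the LOCAL centralizer-quotient σ-algebras of the v3 letter (Borel), so that ★ CARD 11 reads clause (E2) in the same instances
  letI : ∀ (w : {w : InfinitePlace L // w.IsComplex}) (δ : ↥(archLocal L 3 (phi3 L) w)),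
      MeasurableSpace (↥(archLocal L 3 (phi3 L) w) ⧸ Subgroup.centralizer ({δ} : Set ↥(archLocal L 3 (phi3 L) w))) := fun _ _ => borel _
  haveI : ∀ (w : {w : InfinitePlace L // w.IsComplex}) (δ : ↥(archLocal L 3 (phi3 L) w)),
      BorelSpace (↥(archLocal L 3 (phi3 L) w) ⧸ Subgroup.centralizer ({δ} : Set ↥(archLocal L 3 (phi3 L) w))) := fun _ _ => ⟨rfl⟩
  obtain ⟨d, hE1, hE23⟩ := hLoc ν νH mH mG tH t hW hC hH hnd hex νw hν
  exact ⟨d, hE1, fun u =>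
    ⟨isArchStablyNull_archTensor_update_of_isArchLocStablyNull L hW hC νw hν (fun w => (d w).φ (d w).bpos) u
        ((d u).φ (d u).bpos - (d u).φ (d u).bneg) (hE23 u).1,
      (hE23 u).2⟩⟩

end Bridge

end Summit.HodgeConjecture.HodgeConjecture.R90.S2

end
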